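import Summits.QuantumFields.BalabanUV.T4Continuum.Spine.NE1p.DressedSmallFieldLabelCounts
import Summits.QuantumFields.BalabanUV.T4Continuum.Spine.NE1p.DressedSmallFieldOuterLabelsWitness
import Summits.QuantumFields.BalabanUV.T4Continuum.Spine.NE1p.DressedSmallFieldComponentsWitnessLive

/-!
# T⁴ programme, spine estimate NE1′ (node O3b/H2) — WITNESS «N0x's THREE TABLE-FREE COUNTS FIRE ON THE CREW's DECIDED LABEL DATA»:
# the owner's `count_innerLabels_geometry` ∕ `count_outerLabels_geometry` ∕ `count_components_geometry`
# (`Spine/NE1p/DressedSmallFieldLabelCounts`, N0x PART 1) APPLIED ONCE EACH BY NAME — decided appliers — on pv22's torus at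
# W50.1's inner labels, W52.1's outer labels and W53.1's component labels, every binder SUPPLIED by the witnesses' named lemmas

Cell `pub-balaban`, sub-cell `t4`, row NE1′ formalisation crew (`t4/formal/NE1p/LEAVES.md` row W61 ∕ DAG N29zzzk — OPEN OFFER O-g11x of
typer R-T133 (ii), HOME/CLAIMS.log l.21219; INTENT l.21271, STAGED l.21365, BOOKED typer R-T134 l.21443; X185 its read), unit
`b2b-balaban-t4-ne1p-formalise-leaf-06` (gen 12).  ADDITIVE — imports the
owner's N0x.1 `Spine/NE1p/DressedSmallFieldLabelCounts` (t4-ne1p-p1 g30, p235732; → N0w → N0v → N0u → N0t → N0s → …), the crew's W52.1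
`Spine/NE1p/DressedSmallFieldOuterLabelsWitness` (leaf-09 g12, p235179; → N0v + W50.1 `DressedSmallFieldInnerLabelsWitness` (leaf-06 g11)
→ S40.1 `DressedSmallFieldInnerLink` (leaf-07 g16) + W45 `DressedSmallFieldFamiliesWitness` (leaf-10 g10) → …) and W53.2
`Spine/NE1p/DressedSmallFieldComponentsWitnessLive` (leaf-10 g11, p235587; → W53.1 `DressedSmallFieldComponentsWitness` p235285 → N0w +
S40.1 + W45 + W50.1) ONLY; THEOREMS ONLY (0 `def`, 0 `def … : Prop`, 0 cite, 0 sorry, 0 `attribute`); nothing of N0x ∕ N0u ∕ N0v ∕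
N0w ∕ W50 ∕ W52 ∕ W53 ∕ W45 ∕ W41 ∕ S40.1 ∕ pv22 is restated — `count_innerLabels_geometry`, `count_outerLabels_geometry`,
`count_components_geometry`, `termsI`, `hadm_I`, `hb₀_I`, `hRR_I`, `sI`, `sI_pos`, `sI_le_one`, `RI`, `pI`, `pI_pos`, `sum_termsI_X₀`,
`link_torus`, `link_torus'`, `termsO`, `nO`, `nO_nonneg`, `vO`, `vO_pos`, `majO`, `majO_pos`, `hmember_O`, `hRR_O`, `hadm_O`,
`sum_majO_X₀`, `mO_X₀`, `card_termsO_X₀`, `termsC`, `mC`, `mC_nonneg`, `εC`, `εC_pos`, `vC`, `vC_pos`, `anc₁`, `majC`, `majC_nonneg`,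
`hinner_C`, `hanchor_C`, `hA_C`, `htransfer_C`, `hκR_C`, `hrate2_C`, `h229_C`, `hRR_C`, `hadm_C`, `majC_sum_X₀`, `termsC_X₀_card`,
W45's `α₆F`∕`α₆F_pos`∕`δF`∕`κF`∕`hκ_F`∕`h229_F`, W41's `dj_X₀`, W24's `X₀` are
used BY NAME.

WHY (typer R-T133 (ii), ANSWER to leaf-06-g11's question (3)).  The owner's N0x.1 CUT the three table-blind counts of print's
second, third and fourth resummation steps OUT of the proofs of N0u ∕ N0v ∕ N0w's table-pencil ENDs, as named theorems whose
signatures carry NO carrier, potential frame, core, operator point, table, direction, source or cutoff — only the two domain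
geometries, the reading maps and the rates (`DressedSmallFieldLabelCounts` l.95 ∕ l.150 ∕ l.205).  Every decided witness of the crew
(W50 inner labels, W52 outer labels, W53 anchored components) fires an END, inside whose proof the count is re-derived; the three
NAMED counts have 0 appliers in `Spine/NE1p` outside N0x (`grep -ln 'count_innerLabels_geometry\|count_outerLabels_geometry\|
count_components_geometry'` = N0x.1 + N0x.2 at this file's INTENT).  Here each count is applied EXACTLY ONCE BY NAME on pv22's torus
`(tsys 4 N, tgeometry 4 N)` (every `N`) at the crew's DECIDED label data, with every binder SUPPLIED by a named lemma of W50.1 ∕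
W52.1 ∕ W53.1 ∕ W45 ∕ S40.1 — the same terms those witnesses pass to the ENDs — at the step rate `Rkp := 2κ₀ + 2`:
* §1 `innerCount_fires` — N0x §1 ONCE at W50.1's `termsI` (`foot := id`, bonds READ AS CUBES `bondsOf := id`, `b₀ = t = 1`,
  `s := sI`, count rate `R := RI`, `c₃₂ := 5`, `hlink := link_torus` (S40.1)): `Σ_{l ∈ termsI Z} pI 𝐃·(sI²·1)^{#P} ≤ e^{−(2κ₀+2)·d(Z)}`;
* §2 `outerCount_fires` — N0x §2 ONCE at W52.1's `termsO` (`J := univ : Finset Bool`, `n := nO`, `v := vO`, `c′ := 5`,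
  `hlink := link_torus'`): `Σ_{l ∈ termsO Z} majO l ≤ e^{−(2κ₀+2)·d(Z)}`;
* §3 `componentCount_fires` — N0x §3 ONCE at W53.1's `termsC` (`cl := id`, `anc := anc₁`, `I := univ : Finset Bool`, `m := mC`,
  `ε := εC`, `c₀ := 0`, `R₀ := R₀C`, `Aₐ = ℓ := 1`, `v := vC`, `c′ := 5`, `hlink := link_torus'`): `Σ_{l ∈ termsC Z} majC l ≤
  e^{−(2κ₀+2)·d(Z)}`;
* §4 LOCATED AT THE UNIT CUBE (`dj_X₀ = 0` ⇒ every bound reads `e^0 = 1`) and IN CLOSED FORM through the witnesses' located sums BY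
  NAME: **`innerCount_X₀_closed : α₆F·e^{−5RI} + sI² ≤ 1`** (W50.1 `sum_termsI_X₀`), **`outerCount_X₀_closed : α₆F·e^{−5RI} + vO ≤ 1`**
  (W52.1 `sum_majO_X₀` — the COUNT halves W52.1's hand bound `sum_majO_X₀_le_two`), **`componentCount_X₀_closed : εC + vC ≤ 1`**
  (W53.2 `majC_sum_X₀` — W53.1's `εC_add_vC_le_one`, obtained here FROM THE COUNT instead of by hand);
* §5 GENUINE (non-vacuity as kernel statements): the three decided masses at `X₀` are STRICTLY POSITIVE (`innerMass_X₀_pos`,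
  `outerMass_X₀_pos`, `componentMass_X₀_pos`), so each fired count is an inequality `0 < mass ≤ bound` between a positive decided
  mass and N0x's bound — the (2.27)∕(2.29)∕(2.31)–(2.39)-KIND bookkeeping is exercised on inhabited label sets (2, 3 and 3 labels:
  W50.1 `card_termsI_X₀`, W52.1 `card_termsO_X₀`, W53.2 `termsC_X₀_card`), at the located numerals, with the rate clauses of the
  three witnesses met WITH EQUALITY (`hRR_I_eq`, `hRR_O_eq`, `hRR_C_eq` — one unit of rate per uncovered cube).

WORDING OF RECORD (row W61, typer R-T134 (ii) — title «N0x's THREE TABLE-FREE COUNTS FIRE ON THE CREW's DECIDED LABEL DATA —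
`count_innerLabels_geometry` ∕ `count_outerLabels_geometry` ∕ `count_components_geometry` APPLIED ONCE EACH on W50∕W52∕W53's `termsI`∕
`termsO`∕`termsC` at pv22's torus, with the three closed forms `≤ 1` and `0 <` re-obtained FROM THE COUNTS»; O-g11x, R-T133 (ii)): «decided
appliers» of the owner's three counts; THEOREMS ONLY; S40.1 §4's torus face is NOT
re-fired here (the typer: decoration unless bundled as one `example`; the by-name terms above already pass through S40.1's
`link_torus`∕`link_torus'`, and W50.1's `hAmp_I` is typed in the `Geometry` letter, not §4's located letter — no `example` filed).

HONEST FRAMING.  A DECIDED TOY ([folklore]; 0 sorry; 0 citations; 0 `def`): by-name applications of the OWNER's kernel count theorems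
(finite combinatorics ∕ real arithmetic over `Geometry` HYPOTHESIS structures, b13's PROVED (2.29) inside) to the CREW's decided label
data on pv22's CONSTRUCTED torus; the identification of the torus domains with Bałaban's 𝐃_k ∕ 𝐃_{k+1} is pv22's READING (D-pv22.3);
the label sets `termsI`∕`termsO`∕`termsC`, the weights `sI`∕`nO`∕`vO`∕`mC`∕`εC`∕`vC` and the rates `RI`∕`R₀C` are OUR toy choices over
pv22's located letters `κ₀ = 64 log 162`, `K₀(64,8)`, `c₁ = 64`, `ν = 9`; (B3-count) for Bałaban's labels, (B1b) (`hadm`: the terms of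
`Z` ARE these labels) and (B3-form) (`hAmp`) are NOT discharged for Bałaban's (2.14) data — (B3-amp) stays UNPRINTED for Bałaban's
cores (GAPS G-ne9p2-5); print's (2.27), (2.29), (2.31)–(2.39), `e^{−(κ₁−1)}`, «½Lκ», (L+2)⁴ are N0x's DISPLAYED KIND, TYPE∕CONTEXT only
— no numeral of [Balaban1988RGII] is asserted as a fact about Bałaban's densities; 0 binders instantiated on Bałaban's densities; no
wall item; wall v1.8 (T4-DAG v48) does NOT move; R-t4r2-Q2 NOT met thereby; NE1′ ⇐ the named binders — NOT proved, NOT printed; spine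
PROVED 0∕9; count 9 unchanged.  Rung (B)+1 on ONE finite four-torus — NOT infinite volume, NOT a mass gap, NOT OS on ℝ⁴, NOT Clay.
HONEST DEPENDENCY: continuum YM on T⁴ ⇐ BetaPertH ∧ nine spine estimates (0/9 proved); BetaPertH ⇐ (D1) ∧ (D4) ∧ CAP+tail; G-an2-4
gates asym, D1 and NE2/3/4.
-/

noncomputable section

namespace Summit.QuantumFields.BalabanUV.T4Continuum.NE1p.DressedSmallFieldLabelCountsWitness

open scoped BigOperators
open Literature.MathematicalPhysics.QuantumFieldTheory.Balaban1983to89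
open Literature.MathematicalPhysics.QuantumFieldTheory.Balaban1983to89.TreeLengthTorus (TPt TDom tsys torusTreeLen)
open Literature.MathematicalPhysics.QuantumFieldTheory.Balaban1983to89.TreeLengthTorusGeometry (tgeometry)
open Summit.QuantumFields.BalabanUV.T4Continuum.NE1p.DressedSmallFieldTorusWitness (X₀ X₀_val)
open Summit.QuantumFields.BalabanUV.T4Continuum.NE1p.DressedSmallFieldDepCoresWitness (dj_X₀)
open Summit.QuantumFields.BalabanUV.T4Continuum.NE1p.DressedSmallFieldFamiliesWitness (δF κF α₆F α₆F_pos hκ_F h229_F)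
open Summit.QuantumFields.BalabanUV.T4Continuum.NE1p.DressedSmallFieldInnerLink (link_torus link_torus')
open Summit.QuantumFields.BalabanUV.T4Continuum.NE1p.DressedSmallFieldInnerLabelsWitness (RI RI_pos sI sI_pos sI_le_one hb₀_I hRR_I
  termsI hadm_I pI pI_pos sum_termsI_X₀ card_termsI_X₀)
open Summit.QuantumFields.BalabanUV.T4Continuum.NE1p.DressedSmallFieldOuterLabelsWitness (vO vO_pos nO nO_nonneg hmember_O hRR_O termsO
  hadm_O majO majO_pos sum_majO_X₀ card_termsO_X₀)
open Summit.QuantumFields.BalabanUV.T4Continuum.NE1p.DressedSmallFieldComponentsWitness (R₀C vC vC_pos εC εC_pos anc₁ hanchor_C hA_C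
  htransfer_C hκR_C hrate2_C h229_C hRR_C mC mC_nonneg hinner_C termsC hadm_C majC majC_sum_X₀ termsC_X₀_card)
open Summit.QuantumFields.BalabanUV.T4Continuum.NE1p.DressedSmallFieldLabelCounts (count_innerLabels_geometry count_outerLabels_geometry
  count_components_geometry)

section Torus
variable (N : ℕ) [NeZero N]

/-- The step rate is non-negative: `0 ≤ 2κ₀ + 2` (N0x's binder `hRkp`; pv22's `κ₀ ≥ 0`). [arith] -/
theorem stepRate_nonneg : 0 ≤ 2 * (tgeometry 4 N).κ₀ + 2 := by linarith [(tgeometry 4 N).κ₀_nonneg]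

/-! ## §1 THE SECOND STEP's COUNT FIRES on W50.1's inner labels (N0x §1 ONCE BY NAME) -/

open Classical in
/-- **N0x's `count_innerLabels_geometry` FIRES** [decided toy]: ONE geometry `(tsys 4 N, tgeometry 4 N)` at both scales (`foot := id`,
`hmono := le_rfl`), bonds read as cubes (`bondsOf := id`, `b₀ := 1`, W50.1's `hb₀_I`), W45's `α₆F`∕`δF·κF` with `hκ_F`∕`h229_F`,
`s := sI` (`sI_pos`∕`sI_le_one`), `t := 1`, the count rate `R := RI`, `c₃₂ := 5` with `hlink := link_torus` (S40.1 BY NAME),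
`Rkp := 2κ₀+2` with W50.1's `hRR_I`, `hadm := hadm_I` — for EVERY torus polymer `Z`.  Conclusion LITERAL (N0x §1's, the per-family
product being W50.1's `pI` by `rfl`). [folklore] -/
theorem innerCount_fires (Z : TDom 4 N) :
    ∑ l ∈ termsI N Z, pI N l.2.1 * (sI N ^ 2 * 1) ^ l.2.2.card ≤ Real.exp (-((2 * (tgeometry 4 N).κ₀ + 2) * (tsys 4 N).dj Z)) :=
  count_innerLabels_geometry (D := tsys 4 N) (tgeometry 4 N) (fun Z => Z) (fun _ => le_rfl) (fun W => W)
    (δ := δF) (κ := κF) (α₆ := α₆F) (R := RI N) (Rkp := 2 * (tgeometry 4 N).κ₀ + 2) (c₃₂ := 5) (b₀ := 1) (s := sI N) (t := 1)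
    α₆F_pos.le (hκ_F N) (h229_F N) (sI_pos N).le (sI_le_one N) zero_le_one (hb₀_I N) (stepRate_nonneg N) (hRR_I N)
    (fun Z W hW Df hDf => link_torus 4 N Z W hW Df hDf) (hadm_I N) Z

/-! ## §2 THE THIRD AND FOURTH STEPS' COUNT FIRES on W52.1's outer labels (N0x §2 ONCE BY NAME) -/

open Classical in
/-- **N0x's `count_outerLabels_geometry` FIRES** [decided toy]: the step geometry `tgeometry 4 N`, inner data `J := univ : Finset Bool`
with W52.1's `nO`∕`nO_nonneg`∕`hmember_O`, W45's `α₆F`∕`δF·κF`∕`hκ_F`∕`h229_F`, the count rate `R := RI`, `c′ := 5` with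
`hlink := link_torus'` (S40.1 BY NAME), `v := vO`, `Rkp := 2κ₀+2` with W52.1's `hRR_O`, `hadm := hadm_O` — for EVERY torus polymer
`Z`.  Conclusion LITERAL (the summand being W52.1's `majO` by `rfl`). [folklore] -/
theorem outerCount_fires (Z : TDom 4 N) :
    ∑ l ∈ termsO N Z, majO N l ≤ Real.exp (-((2 * (tgeometry 4 N).κ₀ + 2) * (tsys 4 N).dj Z)) :=
  count_outerLabels_geometry (tgeometry 4 N) (fun _ => (Finset.univ : Finset Bool)) (nO N) (nO_nonneg N)
    (a := α₆F) (r := δF * κF) (R := RI N) (Rkp := 2 * (tgeometry 4 N).κ₀ + 2) (c' := 5) (v := vO N)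
    α₆F_pos.le (vO_pos N).le (hκ_F N) (h229_F N) (hmember_O N) (fun Z W hW F hF => link_torus' 4 N Z W hW F hF)
    (stepRate_nonneg N) (hRR_O N) (hadm_O N) Z

/-! ## §3 THE COMPONENT STEP's COUNT FIRES on W53.1's anchored-component labels (N0x §3 ONCE BY NAME) -/

open Classical in
/-- **N0x's `count_components_geometry` FIRES** [decided toy]: step and scale-`k` geometry the torus `tgeometry 4 N` (`cl := id`,
`ℓ := 1`), the one-cube anchor `anc₁` (`Aₐ := 1`; W53.1's `hanchor_C`∕`hA_C`), inner data `I := univ : Finset Bool` with W53.1's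
`mC`∕`mC_nonneg`∕`hinner_C` (`c₀ := 0`, `R₀ := R₀C`), `htransfer_C`, `hκR_C`, `hrate2_C` (`r := δF·κF`, `R := RI`), `ε := εC` with
`h229_C`, `c′ := 5` with `hlink := link_torus'` (S40.1 BY NAME), `v := vC`, `Rkp := 2κ₀+2` with `hRR_C`, `hadm := hadm_C` — for
EVERY torus polymer `Z`.  Conclusion LITERAL (the summand being W53.1's `majC` by `rfl`). [folklore] -/
theorem componentCount_fires (Z : TDom 4 N) :
    ∑ l ∈ termsC N Z, majC N l ≤ Real.exp (-((2 * (tgeometry 4 N).κ₀ + 2) * (tsys 4 N).dj Z)) :=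
  count_components_geometry (tgeometry 4 N) (tgeometry 4 N) (fun _ => (Finset.univ : Finset Bool)) (mC N) (mC_nonneg N)
    (fun Z : TDom 4 N => Z) (anc₁ N)
    (ε := εC N) (c₀ := 0) (R₀ := R₀C N) (Aₐ := 1) (ℓ := 1) (r := δF * κF) (R := RI N) (Rkp := 2 * (tgeometry 4 N).κ₀ + 2)
    (c' := 5) (v := vC N)
    (εC_pos N).le (vC_pos N).le (hinner_C N) (hanchor_C N) (hA_C N) (htransfer_C N) (hκR_C N) (hrate2_C N) (hκ_F N) (h229_C N)
    (link_torus' 4 N) (stepRate_nonneg N) (hRR_C N) (hadm_C N) Z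

/-! ## §4 LOCATED AT THE UNIT CUBE: the three bounds read `1`, the three masses in closed form -/

/-- At the unit cube every count bound is `1`: `e^{−(2κ₀+2)·d(X₀)} = e^0` (W41's `dj_X₀`). [arith] -/
theorem bound_X₀ : Real.exp (-((2 * (tgeometry 4 N).κ₀ + 2) * (tsys 4 N).dj (X₀ N))) = 1 := by
  rw [dj_X₀, mul_zero, neg_zero, Real.exp_zero]

open Classical in
/-- **THE SECOND STEP's COUNT AT `X₀`**: `Σ_{l ∈ termsI X₀} pI·(sI²)^{#P} ≤ 1`. [folklore] -/
theorem innerCount_X₀ : ∑ l ∈ termsI N (X₀ N), pI N l.2.1 * (sI N ^ 2 * 1) ^ l.2.2.card ≤ 1 := by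
  have h := innerCount_fires N (X₀ N); rwa [bound_X₀] at h

open Classical in
/-- **THE SECOND STEP's MASS AT `X₀` IN CLOSED FORM** (W50.1's `sum_termsI_X₀` BY NAME: the covered label `⟨∅, ({X₀}, ∅)⟩` weighs
`pI {X₀} = α₆F·e^{−5RI}` (`dj_X₀`), the uncovered label `⟨{0}, (∅, {0})⟩` weighs `pI ∅·(sI²)¹ = sI²`). [folklore] -/
theorem innerMass_X₀_eq : ∑ l ∈ termsI N (X₀ N), pI N l.2.1 * (sI N ^ 2 * 1) ^ l.2.2.card =
    α₆F * Real.exp (-(RI N * 5)) + sI N ^ 2 := by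
  rw [sum_termsI_X₀]
  show pI N {X₀ N} * (sI N ^ 2 * 1) ^ (∅ : Finset (TPt 4 N)).card + pI N ∅ * (sI N ^ 2 * 1) ^ ({0} : Finset (TPt 4 N)).card = _
  unfold pI
  rw [Finset.prod_singleton, Finset.prod_empty, Finset.card_empty, Finset.card_singleton, dj_X₀, mul_zero, neg_zero,
    Real.exp_zero, mul_one, zero_add, pow_zero, mul_one, pow_one, one_mul, mul_one]

/-- **`α₆F·e^{−5RI} + sI² ≤ 1` FROM THE COUNT** (N0x §1 at `X₀`, read through W50.1's closed form). [folklore] -/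
theorem innerCount_X₀_closed : α₆F * Real.exp (-(RI N * 5)) + sI N ^ 2 ≤ 1 := by
  have h := innerCount_X₀ N; rwa [innerMass_X₀_eq] at h

open Classical in
/-- **THE THIRD∕FOURTH STEPS' COUNT AT `X₀`**: `Σ_{l ∈ termsO X₀} majO l ≤ 1`. [folklore] -/
theorem outerCount_X₀ : ∑ l ∈ termsO N (X₀ N), majO N l ≤ 1 := by
  have h := outerCount_fires N (X₀ N); rwa [bound_X₀] at h

/-- **`α₆F·e^{−5RI} + vO ≤ 1` FROM THE COUNT** (N0x §2 at `X₀`, read through W52.1's `sum_majO_X₀`) — HALF of W52.1's hand bound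
`sum_majO_X₀_le_two`. [folklore] -/
theorem outerCount_X₀_closed : α₆F * Real.exp (-(RI N * 5)) + vO N ≤ 1 := by
  classical
  have h := outerCount_X₀ N; rwa [sum_majO_X₀] at h

open Classical in
/-- **THE COMPONENT STEP's COUNT AT `X₀`**: `Σ_{l ∈ termsC X₀} majC l ≤ 1`. [folklore] -/
theorem componentCount_X₀ : ∑ l ∈ termsC N (X₀ N), majC N l ≤ 1 := by
  have h := componentCount_fires N (X₀ N); rwa [bound_X₀] at h

/-- **`εC + vC ≤ 1` FROM THE COUNT** (N0x §3 at `X₀`, read through W53.2's `majC_sum_X₀`) — W53.1's `εC_add_vC_le_one`, derived by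
hand there, here a consequence of the owner's count. [folklore] -/
theorem componentCount_X₀_closed : εC N + vC N ≤ 1 := by
  classical
  have h := componentCount_X₀ N; rwa [majC_sum_X₀] at h

/-! ## §5 GENUINE: the three fired counts bound POSITIVE decided masses (inhabited label sets, positive weights) -/

open Classical in
/-- **THE SECOND STEP's MASS AT `X₀` IS POSITIVE** (two labels — W50.1's `card_termsI_X₀ = 2` —, `pI > 0`, `sI > 0`). [folklore] -/
theorem innerMass_X₀_pos : 0 < ∑ l ∈ termsI N (X₀ N), pI N l.2.1 * (sI N ^ 2 * 1) ^ l.2.2.card := by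
  refine Finset.sum_pos (fun l _ => mul_pos (pI_pos N _) (pow_pos (by have := sI_pos N; positivity) _)) ?_
  rw [← Finset.card_pos, card_termsI_X₀]; norm_num

open Classical in
/-- **THE THIRD∕FOURTH STEPS' MASS AT `X₀` IS POSITIVE** (three labels — W52.1's `card_termsO_X₀ = 3` —, `majO > 0`). [folklore] -/
theorem outerMass_X₀_pos : 0 < ∑ l ∈ termsO N (X₀ N), majO N l := by
  refine Finset.sum_pos (fun l _ => majO_pos N l) ?_
  rw [← Finset.card_pos, card_termsO_X₀]; norm_num

open Classical in
/-- **THE COMPONENT STEP's MASS AT `X₀` IS POSITIVE** (three labels — W53.2's `termsC_X₀_card = 3` —; in closed form `εC + vC` by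
W53.2's `majC_sum_X₀`, with `εC > 0`, `vC > 0`). [folklore] -/
theorem componentMass_X₀_pos : 0 < ∑ l ∈ termsC N (X₀ N), majC N l := by
  rw [majC_sum_X₀]; exact add_pos (εC_pos N) (vC_pos N)

open Classical in
/-- **THE THREE COUNTS FIRE NON-VACUOUSLY AT THE UNIT CUBE**: each is an inequality `0 < mass ≤ 1` between a positive decided mass
and the owner's bound. [folklore] -/
theorem counts_fire_nonvacuously_X₀ :
    (0 < ∑ l ∈ termsI N (X₀ N), pI N l.2.1 * (sI N ^ 2 * 1) ^ l.2.2.card ∧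
        ∑ l ∈ termsI N (X₀ N), pI N l.2.1 * (sI N ^ 2 * 1) ^ l.2.2.card ≤ 1) ∧
      (0 < ∑ l ∈ termsO N (X₀ N), majO N l ∧ ∑ l ∈ termsO N (X₀ N), majO N l ≤ 1) ∧
        (0 < ∑ l ∈ termsC N (X₀ N), majC N l ∧ ∑ l ∈ termsC N (X₀ N), majC N l ≤ 1) :=
  ⟨⟨innerMass_X₀_pos N, innerCount_X₀ N⟩, ⟨outerMass_X₀_pos N, outerCount_X₀ N⟩, ⟨componentMass_X₀_pos N, componentCount_X₀ N⟩⟩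

/-- **EVERY fired count bounds a non-negative mass by a bound `≤ 1`** (all polymers): the step rate is `≥ 0` and `d(Z) ≥ 0`. [arith] -/
theorem bound_le_one (Z : TDom 4 N) : Real.exp (-((2 * (tgeometry 4 N).κ₀ + 2) * (tsys 4 N).dj Z)) ≤ 1 :=
  Real.exp_le_one_iff.2 (neg_nonpos.2 (mul_nonneg (stepRate_nonneg N) ((tsys 4 N).dj_nonneg Z)))

end Torus

end Summit.QuantumFields.BalabanUV.T4Continuum.NE1p.DressedSmallFieldLabelCountsWitness

end
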